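import Summits.QuantumFields.YangMills.Theorems.AlphaInputsT3ACv3AbelianShapes1D
import Summits.QuantumFields.YangMills.Theorems.AlphaInputsT3ACv3AbelianLiftAvg
import Literature.MathematicalPhysics.QuantumFieldTheory.Balaban1983to89.T3ContinuumYM3Torus
import HarnessLib

/-!
# `AlphaInputsT3ACv3AbelianTensor` — STRATEGY B for 2′, (LL) the linear regional lift: THE TENSOR-PRODUCT CORRECTORS ON THE 3-TORUS AND THEIR CURL IDENTITIES — lane
# `pub-balaban3d`, seat alpha-2 (g5)

WHY.  The exact finest lift of a coarse one-form `A` (sibling `…v3AbelianRegionalLift`) is `naive(A) + Σ_P (curl A)(P)·e_P + Σ_C φ_C·r_C`: the naive crossing-bond lift has its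
curl concentrated on the block edge-lines (`(curl A)(P)` on the corner line of `P`); the PLAQUETTE CORRECTOR `e_P` (a tensor product of the 1D shapes of `…v3AbelianShapes1D` over
the three axes) trades the corner line for the smooth 2-form `σ_P = h ⊗ h ⊗ N` plus CUBE TERMS `K_{C₊(P)} − K_{C₋(P)}` attached to the two cubes adjacent to `P`; over the six faces of
a cube the cube terms add up to `(d curl A)(C)·K_C = 0` — except at PARTIAL cubes (a corner block outside the region), where the CUBE CORRECTOR `r_C` moves `K_C` to the system
hosted in an outside corner block (`K_C^{θ}`, invisible under the region) at the price of a smooth remainder `Y_C`.  THIS FILE (the `K`-th approximation of a `T3Family`, coarse level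
`k`, `n = L^k` finest sites per block, period `N₀ = n·n_c`): §1 the cyclic offsets `ρ_i(y, z) = z_i − n·y_i (mod N₀)` of a finest site from a level-`k` site and their behaviour under
finest shifts; §2 one-forms from three component functions (`form3`) and their curls; §3 the correctors `e01, e02, e12` of the three plaquette orientations, the cube terms `Kc`, the
smooth parts `sig`, the corner lines `cl`, the cube corrector `rC` and its remainder `Yc`; §4 ★ the twelve pointwise curl identities (three per face orientation, three for the cube
corrector), each an instance of the 1D difference relations.
HONEST FRAMING.  Kernel algebra of explicit lattice functions; nothing of [B10]∕[7]∕[4] asserted; count-neutral helper toward R3 2′ (`stub_laneRecordsV3`, items 19935∕19936);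
registry untouched; nothing about d = 4, the continuum, or a mass gap.

References: T. Bałaban, Commun. Math. Phys. 102 (1985) 277–309 [Balaban1985Variational] ((8) p.279); CMP 109 (1987) 249–301 [Balaban1987RG1] ((0.3)–(0.4) pp.252–253).
-/

set_option autoImplicit false

noncomputable section

namespace Summit.QuantumFields.YangMills.Theorems.AbelianEML.Tensor

open scoped BigOperators
open Literature.MathematicalPhysics.QuantumFieldTheory.Balaban1983to89
open Literature.MathematicalPhysics.QuantumFieldTheory.Balaban1983to89.T3ContinuumYM3Torus
open Summit.QuantumFields.YangMills.Theorems.AbelianEML.Shapes1D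

variable {F : T3Family} {K k : ℕ}

/-! ## §1 Cyclic offsets of a finest site from a level-`k` site -/

/-- `n_c`, the number of level-`k` sites per direction. [cite: Balaban1987RG1, (0.1) p.251] -/
abbrev nc (F : T3Family) (K k : ℕ) : ℕ := (F.P K).sitesPerDir k

/-- `N₀`, the number of finest sites per direction. [cite: Balaban1987RG1, (0.1) p.251] -/
abbrev N0 (F : T3Family) (K : ℕ) : ℕ := (F.P K).sitesPerDir 0

/-- **THE CYCLIC OFFSET** `ρ_i(y, z) ≡ z_i − L^k·y_i (mod N₀)`, as a natural number `z_i + (N₀ − L^k·y_i)`. [cite: Balaban1987RG1, (0.3) p.252] -/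
def rho (y : Site (F.P K) k) (z : Site (F.P K) 0) (i : Fin 3) : ℕ := (z i).val + (N0 F K - F.L ^ k * (y i).val)

/-- Under a finest shift in direction `α` the offsets move by `[i = α]` modulo the period. [folklore] -/
theorem rho_shift_mod (y : Site (F.P K) k) (z : Site (F.P K) 0) (α i : Fin 3) :
    rho y (z.shift α) i % N0 F K = (rho y z i + if i = α then 1 else 0) % N0 F K := by
  simp only [rho, Site.shift_apply]
  by_cases h : i = α
  · subst h
    simp only [if_true]
    rw [ZMod.val_add, ZMod.val_one, Nat.add_mod, Nat.mod_mod, ← Nat.add_mod]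
    congr 1; ring
  · simp [h]

/-- Periodic shapes at shifted sites: the crossing bond. [folklore] -/
theorem cS_rho_shift (n : ℕ) (y : Site (F.P K) k) (z : Site (F.P K) 0) (α i : Fin 3) :
    cS n (N0 F K) (rho y (z.shift α) i) = cS n (N0 F K) (rho y z i + if i = α then 1 else 0) := cS_congr (rho_shift_mod y z α i)
/-- Periodic shapes at shifted sites: the block. [folklore] -/
theorem bS_rho_shift (n : ℕ) (y : Site (F.P K) k) (z : Site (F.P K) 0) (α i : Fin 3) :
    bS n (N0 F K) (rho y (z.shift α) i) = bS n (N0 F K) (rho y z i + if i = α then 1 else 0) := bS_congr (rho_shift_mod y z α i)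
/-- Periodic shapes at shifted sites: the bond profiles. [folklore] -/
theorem hS_rho_shift (θ : Bool) (n : ℕ) (y : Site (F.P K) k) (z : Site (F.P K) 0) (α i : Fin 3) :
    hS θ n (N0 F K) (rho y (z.shift α) i) = hS θ n (N0 F K) (rho y z i + if i = α then 1 else 0) := hS_congr θ (rho_shift_mod y z α i)
/-- Periodic shapes at shifted sites: the cumulatives. [folklore] -/
theorem gS_rho_shift (θ : Bool) (n : ℕ) (y : Site (F.P K) k) (z : Site (F.P K) 0) (α i : Fin 3) :
    gS θ n (N0 F K) (rho y (z.shift α) i) = gS θ n (N0 F K) (rho y z i + if i = α then 1 else 0) := gS_congr θ (rho_shift_mod y z α i)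
/-- Periodic shapes at shifted sites: the site shape. [folklore] -/
theorem NS_rho_shift (n : ℕ) (y : Site (F.P K) k) (z : Site (F.P K) 0) (α i : Fin 3) :
    NS n (N0 F K) (rho y (z.shift α) i) = NS n (N0 F K) (rho y z i + if i = α then 1 else 0) := NS_congr (rho_shift_mod y z α i)

/-! ## §2 One-forms from three component functions -/

/-- A finest one-form from its three components `e_μ(z)` (value on the bond `⟨z, μ⟩`). [cite: Balaban1985Averaging, (3) p.18] -/
def form3 (e : Fin 3 → Site (F.P K) 0 → ℝ) : PBond (F.P K) 0 → ℝ := fun b => e b.dir b.src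

/-- The curl of a `form3` one-form: `e_α(z) + e_β(z + e_α) − e_α(z + e_β) − e_β(z)`. [cite: Balaban1985Averaging, (9) p.19] -/
theorem curlAt_form3 (e : Fin 3 → Site (F.P K) 0 → ℝ) (z : Site (F.P K) 0) (α β : Fin 3) :
    curlAt (form3 e) z α β = e α z + e β (z.shift α) - e α (z.shift β) - e β z := rfl

/-! ## §3 The correctors -/

section Defs

variable (F K k)

/-- Shorthand: the base (home-hosted) shapes at offset `ρ`, block size `L^k`, period `N₀`. -/
abbrev c_ (ρ : ℕ) : ℝ := cS (F.L ^ k) (N0 F K) ρ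
/-- Shorthand: block indicator. -/
abbrev b_ (ρ : ℕ) : ℝ := bS (F.L ^ k) (N0 F K) ρ
/-- Shorthand: hosted bond profile. -/
abbrev h_ (θ : Bool) (ρ : ℕ) : ℝ := hS θ (F.L ^ k) (N0 F K) ρ
/-- Shorthand: hosted cumulative. -/
abbrev g_ (θ : Bool) (ρ : ℕ) : ℝ := gS θ (F.L ^ k) (N0 F K) ρ
/-- Shorthand: base site shape. -/
abbrev N_ (ρ : ℕ) : ℝ := NS (F.L ^ k) (N0 F K) ρ

/-- **THE CORRECTOR OF A `(0,1)`-PLAQUETTE** `P = (y; 0, 1)` (third axis `2`): `e₁ = g₀ c₁ b₂`, `e₀ = −h₀ g₁ b₂`, `e₂ = 0` (the tensor homotopy between the naive and the smooth lift).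
[cite: Balaban1985Variational, (8) p.279] -/
def e01 (y : Site (F.P K) k) : PBond (F.P K) 0 → ℝ := form3 fun μ z =>
  if μ = 0 then -(h_ F K k false (rho y z 0) * g_ F K k false (rho y z 1) * b_ F K k (rho y z 2))
  else if μ = 1 then g_ F K k false (rho y z 0) * c_ F K k (rho y z 1) * b_ F K k (rho y z 2) else 0

/-- **THE CORRECTOR OF A `(0,2)`-PLAQUETTE** (third axis `1`): `e₂ = g₀ b₁ c₂`, `e₀ = −h₀ N₁ g₂`, `e₁ = 0`. [cite: Balaban1985Variational, (8) p.279] -/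
def e02 (y : Site (F.P K) k) : PBond (F.P K) 0 → ℝ := form3 fun μ z =>
  if μ = 0 then -(h_ F K k false (rho y z 0) * N_ F K k (rho y z 1) * g_ F K k false (rho y z 2))
  else if μ = 2 then g_ F K k false (rho y z 0) * b_ F K k (rho y z 1) * c_ F K k (rho y z 2) else 0

/-- **THE CORRECTOR OF A `(1,2)`-PLAQUETTE** (third axis `0`): `e₂ = N₀ g₁ c₂`, `e₁ = −N₀ h₁ g₂`, `e₀ = 0`. [cite: Balaban1985Variational, (8) p.279] -/
def e12 (y : Site (F.P K) k) : PBond (F.P K) 0 → ℝ := form3 fun μ z =>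
  if μ = 1 then -(N_ F K k (rho y z 0) * h_ F K k false (rho y z 1) * g_ F K k false (rho y z 2))
  else if μ = 2 then N_ F K k (rho y z 0) * g_ F K k false (rho y z 1) * c_ F K k (rho y z 2) else 0

/-- **THE SMOOTH PART** `σ_P` of the curl of the corrected lift at a plaquette of orientation `(α, β)`: `h_α h_β N_λ`. [cite: Balaban1985Variational, (8) p.279] -/
def sig (αβ : Fin 3) (y : Site (F.P K) k) (z : Site (F.P K) 0) : ℝ :=
  if αβ = 0 then h_ F K k false (rho y z 0) * h_ F K k false (rho y z 1) * N_ F K k (rho y z 2)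
  else if αβ = 1 then h_ F K k false (rho y z 0) * N_ F K k (rho y z 1) * h_ F K k false (rho y z 2)
  else N_ F K k (rho y z 0) * h_ F K k false (rho y z 1) * h_ F K k false (rho y z 2)

/-- **THE CORNER LINE** `cl_P` (the curl of the naive lift of `δ_P`): `c c b` in the two plaquette directions and the third. [cite: Balaban1987RG1, (0.4) p.253] -/
def cl (αβ : Fin 3) (y : Site (F.P K) k) (z : Site (F.P K) 0) : ℝ :=
  if αβ = 0 then c_ F K k (rho y z 0) * c_ F K k (rho y z 1) * b_ F K k (rho y z 2)
  else if αβ = 1 then c_ F K k (rho y z 0) * b_ F K k (rho y z 1) * c_ F K k (rho y z 2)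
  else b_ F K k (rho y z 0) * c_ F K k (rho y z 1) * c_ F K k (rho y z 2)

/-- **THE CUBE TERM** `K_C^θ` of the cube at `y` in the system hosted at the corner `θ ∈ {0,1}³`, with the offsets shifted by `s` (so that `s = n·e_λ` reads the cube BELOW
in direction `λ`), components indexed by orientation (`0 ↔ (0,1)`, `1 ↔ (0,2)`, `2 ↔ (1,2)`): `(h′₀ h′₁ g′₂, −h′₀ g′₁ c₂, g′₀ c₁ c₂)`. [cite: Balaban1985Variational, (8) p.279] -/
def Kc (θ : Fin 3 → Bool) (s : Fin 3 → ℕ) (αβ : Fin 3) (y : Site (F.P K) k) (z : Site (F.P K) 0) : ℝ :=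
  if αβ = 0 then h_ F K k (θ 0) (rho y z 0 + s 0) * h_ F K k (θ 1) (rho y z 1 + s 1) * g_ F K k (θ 2) (rho y z 2 + s 2)
  else if αβ = 1 then -(h_ F K k (θ 0) (rho y z 0 + s 0) * g_ F K k (θ 1) (rho y z 1 + s 1) * c_ F K k (rho y z 2 + s 2))
  else g_ F K k (θ 0) (rho y z 0 + s 0) * c_ F K k (rho y z 1 + s 1) * c_ F K k (rho y z 2 + s 2)

/-- The base system (everything hosted at home). -/
abbrev θ0 : Fin 3 → Bool := fun _ => false

/-- The offset shift reading the cube below in direction `λ`: `n·e_λ`. -/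
def below (lam : Fin 3) : Fin 3 → ℕ := fun i => if i = lam then F.L ^ k else 0

/-- **THE CUBE CORRECTOR** `r_C^θ` moving the base cube term to the system hosted at corner `θ`: `r₂ = −ĝ₀ g′₁ c₂`, `r₁ = ĝ₀ h′₁ g′₂`, `r₀ = −h₀ ĝ₁ g′₂` with `ĝ = g⁰ − g^θ`.
[cite: Balaban1985Variational, (8) p.279] -/
def rC (θ : Fin 3 → Bool) (y : Site (F.P K) k) : PBond (F.P K) 0 → ℝ := form3 fun μ z =>
  if μ = 0 then -(h_ F K k false (rho y z 0) * (g_ F K k false (rho y z 1) - g_ F K k (θ 1) (rho y z 1)) * g_ F K k (θ 2) (rho y z 2))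
  else if μ = 1 then (g_ F K k false (rho y z 0) - g_ F K k (θ 0) (rho y z 0)) * h_ F K k (θ 1) (rho y z 1) * g_ F K k (θ 2) (rho y z 2)
  else -((g_ F K k false (rho y z 0) - g_ F K k (θ 0) (rho y z 0)) * g_ F K k (θ 1) (rho y z 1) * c_ F K k (rho y z 2))

/-- **THE SMOOTH REMAINDER** `Y_C^θ = K_C − K_C^θ − curl r_C^θ`: `(h₀ h₁ ĝ₂, −h₀ ĝ₁ h′₂, ĝ₀ h′₁ h′₂)`. [cite: Balaban1985Variational, (8) p.279] -/
def Yc (θ : Fin 3 → Bool) (αβ : Fin 3) (y : Site (F.P K) k) (z : Site (F.P K) 0) : ℝ :=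
  if αβ = 0 then h_ F K k false (rho y z 0) * h_ F K k false (rho y z 1) * (g_ F K k false (rho y z 2) - g_ F K k (θ 2) (rho y z 2))
  else if αβ = 1 then -(h_ F K k false (rho y z 0) * (g_ F K k false (rho y z 1) - g_ F K k (θ 1) (rho y z 1)) * h_ F K k (θ 2) (rho y z 2))
  else (g_ F K k false (rho y z 0) - g_ F K k (θ 0) (rho y z 0)) * h_ F K k (θ 1) (rho y z 1) * h_ F K k (θ 2) (rho y z 2)

end Defs

/-! ## §4 The pointwise curl identities -/

section Identities

variable (hk : k ≤ K)
include hk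

/-- The standing-range bookkeeping: `N₀ = L^k · n_c`, `n_c ≥ 2`, `L^k ≥ 1`. [cite: Balaban1987RG1, (0.1) p.251] -/
theorem sizes : N0 F K = F.L ^ k * nc F K k ∧ 2 ≤ nc F K k ∧ 1 ≤ F.L ^ k := by
  refine ⟨?_, ?_, Nat.one_le_pow _ _ (by have := F.hL.2; omega)⟩
  · have hk' : k ≤ (F.P K).m + (F.P K).K := le_trans hk (Nat.le_add_left _ _)
    rw [N0, nc, Prop7FlatHolonomy.sitesPerDir_zero_eq_mul_pow hk', mul_comm]; rfl
  · exact (F.P K).one_lt_sitesPerDir k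

/-- Solved form of the cumulative relation. -/
theorem g_succ (θ : Bool) (ρ : ℕ) : g_ F K k θ (ρ + 1) = g_ F K k θ ρ + h_ F K k θ ρ - c_ F K k ρ := by
  obtain ⟨h1, h2, h3⟩ := sizes (F := F) hk
  have := gS_succ_sub h1 h2 h3 θ ρ
  simp only [g_, h_, c_]; linarith

/-- Solved form of the block relation. -/
theorem b_succ (ρ : ℕ) : b_ F K k (ρ + 1) = b_ F K k ρ + c_ F K k (ρ + F.L ^ k) - c_ F K k ρ := by
  obtain ⟨h1, h2, h3⟩ := sizes (F := F) hk
  have := bS_succ_sub h1 h2 h3 ρ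
  simp only [b_, c_]; linarith

/-- Solved form of the site-shape relation. -/
theorem N_succ (ρ : ℕ) : N_ F K k (ρ + 1) = N_ F K k ρ + h_ F K k false (ρ + F.L ^ k) - h_ F K k false ρ := by
  obtain ⟨h1, h2, h3⟩ := sizes (F := F) hk
  have := NS_succ_sub h1 h2 h3 ρ
  simp only [N_, h_]; linarith

omit hk in
/-- The site shape unfolded. -/
theorem N_def (ρ : ℕ) : N_ F K k ρ = b_ F K k ρ + g_ F K k false (ρ + F.L ^ k) - g_ F K k false ρ := rfl

omit hk in
/-- `0 ≠ 1` in `Fin 3`, as a rewrite to `False`. [folklore] -/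
private theorem f01 : ((0 : Fin 3) = 1) = False := by decide
omit hk in
/-- `0 ≠ 2` in `Fin 3`. [folklore] -/
private theorem f02 : ((0 : Fin 3) = 2) = False := by decide
omit hk in
/-- `1 ≠ 0` in `Fin 3`. [folklore] -/
private theorem f10 : ((1 : Fin 3) = 0) = False := by decide
omit hk in
/-- `1 ≠ 2` in `Fin 3`. [folklore] -/
private theorem f12 : ((1 : Fin 3) = 2) = False := by decide
omit hk in
/-- `2 ≠ 0` in `Fin 3`. [folklore] -/
private theorem f20 : ((2 : Fin 3) = 0) = False := by decide
omit hk in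
/-- `2 ≠ 1` in `Fin 3`. [folklore] -/
private theorem f21 : ((2 : Fin 3) = 1) = False := by decide

/-- **★ FACE `(0,1)`, COMPONENT `(0,1)`**: `curl e_P = σ_P − cl_P + (K_{C₊} − K_{C₋})`. [cite: Balaban1985Variational, (8) p.279] -/
theorem curl_e01_01 (y : Site (F.P K) k) (z : Site (F.P K) 0) :
    curlAt (e01 F K k y) z (0 : Fin 3) (1 : Fin 3) = sig F K k 0 y z - cl F K k 0 y z + (Kc F K k θ0 0 0 y z - Kc F K k θ0 (below F k 2) 0 y z) := by
  simp only [e01, curlAt_form3, sig, cl, Kc, below, θ0, cS_rho_shift, bS_rho_shift, hS_rho_shift, gS_rho_shift, f01, f02, f10, f12, f20, f21,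
    ↓reduceIte, add_zero, Pi.zero_apply]
  simp only [g_succ hk]
  simp only [N_def]
  ring

/-- **★ FACE `(0,1)`, COMPONENT `(0,2)`**: `curl e_P = K_{C₊} − K_{C₋}`. [cite: Balaban1985Variational, (8) p.279] -/
theorem curl_e01_02 (y : Site (F.P K) k) (z : Site (F.P K) 0) :
    curlAt (e01 F K k y) z (0 : Fin 3) (2 : Fin 3) = Kc F K k θ0 0 1 y z - Kc F K k θ0 (below F k 2) 1 y z := by
  simp only [e01, curlAt_form3, Kc, below, θ0, bS_rho_shift, hS_rho_shift, gS_rho_shift, f02, f10, f12, f20, f21,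
    ↓reduceIte, add_zero, Pi.zero_apply]
  simp only [b_succ hk]
  ring

/-- **★ FACE `(0,1)`, COMPONENT `(1,2)`**: `curl e_P = K_{C₊} − K_{C₋}`. [cite: Balaban1985Variational, (8) p.279] -/
theorem curl_e01_12 (y : Site (F.P K) k) (z : Site (F.P K) 0) :
    curlAt (e01 F K k y) z (1 : Fin 3) (2 : Fin 3) = Kc F K k θ0 0 2 y z - Kc F K k θ0 (below F k 2) 2 y z := by
  simp only [e01, curlAt_form3, Kc, below, θ0, cS_rho_shift, bS_rho_shift, gS_rho_shift, f02, f10, f12, f20, f21,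
    ↓reduceIte, add_zero, Pi.zero_apply]
  simp only [b_succ hk]
  ring

/-- **★ FACE `(0,2)`, COMPONENT `(0,2)`**: `curl e_P = σ_P − cl_P − (K_{C₊} − K_{C₋})` (third axis `1`, negative orientation). [cite: Balaban1985Variational, (8) p.279] -/
theorem curl_e02_02 (y : Site (F.P K) k) (z : Site (F.P K) 0) :
    curlAt (e02 F K k y) z (0 : Fin 3) (2 : Fin 3) = sig F K k 1 y z - cl F K k 1 y z - (Kc F K k θ0 0 1 y z - Kc F K k θ0 (below F k 1) 1 y z) := by
  simp only [e02, curlAt_form3, sig, cl, Kc, below, θ0, cS_rho_shift, bS_rho_shift, hS_rho_shift, gS_rho_shift, NS_rho_shift, f01, f02, f10, f12, f20, f21,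
    ↓reduceIte, add_zero, Pi.zero_apply]
  simp only [g_succ hk]
  simp only [N_def]
  ring

/-- **★ FACE `(0,2)`, COMPONENT `(0,1)`**: `curl e_P = −(K_{C₊} − K_{C₋})`. [cite: Balaban1985Variational, (8) p.279] -/
theorem curl_e02_01 (y : Site (F.P K) k) (z : Site (F.P K) 0) :
    curlAt (e02 F K k y) z (0 : Fin 3) (1 : Fin 3) = -(Kc F K k θ0 0 0 y z - Kc F K k θ0 (below F k 1) 0 y z) := by
  simp only [e02, curlAt_form3, Kc, below, θ0, hS_rho_shift, gS_rho_shift, NS_rho_shift, f01, f10, f12, f21,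
    ↓reduceIte, add_zero, Pi.zero_apply]
  simp only [N_succ hk]
  simp only [N_def]
  ring

/-- **★ FACE `(0,2)`, COMPONENT `(1,2)`**: `curl e_P = −(K_{C₊} − K_{C₋})`. [cite: Balaban1985Variational, (8) p.279] -/
theorem curl_e02_12 (y : Site (F.P K) k) (z : Site (F.P K) 0) :
    curlAt (e02 F K k y) z (1 : Fin 3) (2 : Fin 3) = -(Kc F K k θ0 0 2 y z - Kc F K k θ0 (below F k 1) 2 y z) := by
  simp only [e02, curlAt_form3, Kc, below, θ0, cS_rho_shift, bS_rho_shift, gS_rho_shift, f01, f10, f12, f20, f21,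
    ↓reduceIte, add_zero, Pi.zero_apply]
  simp only [b_succ hk]
  ring

/-- **★ FACE `(1,2)`, COMPONENT `(1,2)`**: `curl e_P = σ_P − cl_P + (K_{C₊} − K_{C₋})` (third axis `0`). [cite: Balaban1985Variational, (8) p.279] -/
theorem curl_e12_12 (y : Site (F.P K) k) (z : Site (F.P K) 0) :
    curlAt (e12 F K k y) z (1 : Fin 3) (2 : Fin 3) = sig F K k 2 y z - cl F K k 2 y z + (Kc F K k θ0 0 2 y z - Kc F K k θ0 (below F k 0) 2 y z) := by
  simp only [e12, curlAt_form3, sig, cl, Kc, below, θ0, cS_rho_shift, hS_rho_shift, gS_rho_shift, NS_rho_shift, f01, f02, f10, f12, f20, f21,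
    ↓reduceIte, add_zero, Pi.zero_apply]
  simp only [g_succ hk]
  simp only [N_def]
  ring

/-- **★ FACE `(1,2)`, COMPONENT `(0,1)`**: `curl e_P = K_{C₊} − K_{C₋}`. [cite: Balaban1985Variational, (8) p.279] -/
theorem curl_e12_01 (y : Site (F.P K) k) (z : Site (F.P K) 0) :
    curlAt (e12 F K k y) z (0 : Fin 3) (1 : Fin 3) = Kc F K k θ0 0 0 y z - Kc F K k θ0 (below F k 0) 0 y z := by
  simp only [e12, curlAt_form3, Kc, below, θ0, hS_rho_shift, gS_rho_shift, NS_rho_shift, f01, f02, f10, f20, ↓reduceIte, add_zero, Pi.zero_apply]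
  simp only [N_succ hk]
  simp only [N_def]
  ring

/-- **★ FACE `(1,2)`, COMPONENT `(0,2)`**: `curl e_P = K_{C₊} − K_{C₋}`. [cite: Balaban1985Variational, (8) p.279] -/
theorem curl_e12_02 (y : Site (F.P K) k) (z : Site (F.P K) 0) :
    curlAt (e12 F K k y) z (0 : Fin 3) (2 : Fin 3) = Kc F K k θ0 0 1 y z - Kc F K k θ0 (below F k 0) 1 y z := by
  simp only [e12, curlAt_form3, Kc, below, θ0, cS_rho_shift, gS_rho_shift, NS_rho_shift, f01, f02, f10, f20, f21,
    ↓reduceIte, add_zero, Pi.zero_apply]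
  simp only [N_succ hk]
  simp only [N_def]
  ring

/-- **★ CUBE CORRECTOR, COMPONENT `(0,1)`**: `curl r_C^θ = K_C − K_C^θ − Y_C^θ`. [cite: Balaban1985Variational, (8) p.279] -/
theorem curl_rC_01 (θ : Fin 3 → Bool) (y : Site (F.P K) k) (z : Site (F.P K) 0) :
    curlAt (rC F K k θ y) z (0 : Fin 3) (1 : Fin 3) = Kc F K k θ0 0 0 y z - Kc F K k θ 0 0 y z - Yc F K k θ 0 y z := by
  simp only [rC, curlAt_form3, Kc, Yc, θ0, hS_rho_shift, gS_rho_shift, f01, f10, f20, f21,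
    ↓reduceIte, add_zero, Pi.zero_apply]
  simp only [g_succ hk]
  ring

/-- **★ CUBE CORRECTOR, COMPONENT `(0,2)`**. [cite: Balaban1985Variational, (8) p.279] -/
theorem curl_rC_02 (θ : Fin 3 → Bool) (y : Site (F.P K) k) (z : Site (F.P K) 0) :
    curlAt (rC F K k θ y) z (0 : Fin 3) (2 : Fin 3) = Kc F K k θ0 0 1 y z - Kc F K k θ 0 1 y z - Yc F K k θ 1 y z := by
  simp only [rC, curlAt_form3, Kc, Yc, θ0, cS_rho_shift, hS_rho_shift, gS_rho_shift, f02, f10, f12, f20, f21,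
    ↓reduceIte, add_zero, Pi.zero_apply]
  simp only [g_succ hk]
  ring

/-- **★ CUBE CORRECTOR, COMPONENT `(1,2)`**. [cite: Balaban1985Variational, (8) p.279] -/
theorem curl_rC_12 (θ : Fin 3 → Bool) (y : Site (F.P K) k) (z : Site (F.P K) 0) :
    curlAt (rC F K k θ y) z (1 : Fin 3) (2 : Fin 3) = Kc F K k θ0 0 2 y z - Kc F K k θ 0 2 y z - Yc F K k θ 2 y z := by
  simp only [rC, curlAt_form3, Kc, Yc, θ0, cS_rho_shift, hS_rho_shift, gS_rho_shift, f01, f02, f10, f12, f20, f21,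
    ↓reduceIte, add_zero, Pi.zero_apply]
  simp only [g_succ hk]
  ring

end Identities

end Summit.QuantumFields.YangMills.Theorems.AbelianEML.Tensor

end
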